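import Mathlib
import HarnessLib
import Literature.NumberTheory.DiophantineGeometry.SquarefulSums

/-!
# The constant of Browning–Van Valckenborgh's Conjecture 1 is a genuine positive number

Companion to `Literature/NumberTheory/DiophantineGeometry/SquarefulSums.lean`, which transcribes
T. D. Browning and K. Van Valckenborgh, *Sums of three squareful numbers*, Exp. Math. **21** (2012),
204–211, arXiv:1106.4472 [BrowningValckenborgh2012]: the counting function `N₁(B)`
(`squarefulSumCount`) of primitive squareful solutions of `x + y = z`, the conjectural constant
`c = squarefulSumConstant` (formula (2.4) of the paper, a `tsum` over `ℕ³` of `bvvSummand`),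
Theorem 1 (`SquarefulSumLowerBound`), Theorem 2 (`SquarefulSumUpperBound`) and **Conjecture 1**
(`SquarefulSumConjecture`: `N₁(B) ~ c B^{1/2}`).

That file leaves the summability of (2.4) unproved, so that a priori Lean's `tsum` could be the junk
value `0` — which would make `SquarefulSumConjecture` trivially false and `SquarefulSumLowerBound`
trivially true. This file closes that gap:

* `bvvSummand_summable` — the series (2.4) converges;
* `inv_pi_le_squarefulSumConstant`, `squarefulSumConstant_pos` — `c ≥ 1/π > 0` (the term of (2.4)
  at `y = (1, 1, 1)`, the Pythagorean conic, is `1`);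
* `squarefulSumConjecture_iff_tendsto` — consequently Conjecture 1 is *equivalent* to
  `N₁(B) / (c B^{1/2}) → 1`, the quantity tabulated and plotted in Table 1 / Figure 1 of the paper.

## Proof of summability

Termwise, `σ_{2,y} ≤ 2` (`bvvSigmaTwo_le_two`) and each odd Euler factor
`∏_{p ∣ yᵢ, p > 2} (1 + (·/p)) / (1 + 1/p)` is at most `2^{ω(yᵢ)}` (`bvvOddFactor_le_two_pow`), so
`bvvSummand y ≤ 2 ∏ᵢ 2^{ω(yᵢ)} yᵢ^{-3/2}` (`bvvSummand_le`), a product majorant. The one-variable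
series `Σₙ 2^{ω(n)} n^{-3/2}` converges (`summable_two_pow_card_primeFactors_mul_rpow`) because
`2^{ω(n)} ≤ 4 n^{11/25}` (`two_pow_card_primeFactors_le_four_mul_rpow`: at most two prime factors
of `n` lie below `5`, the number `k` of the others satisfies `5^k ≤ n`, and `2^25 ≤ 5^11`), and
`11/25 - 3/2 = -53/50 < -1`. (The paper's sharper remark, §2.4, is that the summand is
`≪ 2^{ω(d)} d^{-3/2}` on the `3^{ω(d)}` triples with `y₀y₁y₂ = d`; any bound `2^{ω(n)} ≪ n^{θ}` with
`θ < 1/2` suffices here.)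

## Status of Conjecture 1 (why there is no `SquarefulSumConjecture_holds`)

Conjecture 1 is an open problem (2026). Theorem 1 of the paper gives
`liminf N₁(B) B^{-1/2} ≥ c`, so "it is the question of upper bounds which remains"
[HeathBrown2026, §1]; Theorem 2 (`N₁(B) ≪ B^{3/5} log¹² B`) was refined to `≪ B^{3/5} (log B)^9`
by X. Zhao [Zhao2025] and to `≪_ε B^{3/5 - 3/1555 + ε}` by D. R. Heath-Brown [HeathBrown2026,
Thm. 1]; no bound with exponent below `3/5 - 3/1555` is known, let alone the asymptotic.
-/

noncomputable section

open Filter Finset Asymptotics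

namespace Literature.NumberTheory.DiophantineGeometry

/-! ### Summability of (2.4) and positivity of `c` -/

/-- `σ_{2,y} ≤ 2` (its values are `0, 1, 2`). [cite: BrowningValckenborgh2012, Lemma 2] -/
theorem bvvSigmaTwo_le_two (y₀ y₁ y₂ : ℕ) : bvvSigmaTwo y₀ y₁ y₂ ≤ 2 := by
  unfold bvvSigmaTwo
  split_ifs <;> norm_num

/-- Each odd-prime Euler factor of (2.4) is at most `2^{ω(n)}`: every factor
`(1 + (a/p)) / (1 + 1/p)` lies in `[0, 2]`. [folklore] -/
theorem bvvOddFactor_le_two_pow (a : ℤ) (n : ℕ) :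
    bvvOddFactor a n ≤ (2 : ℝ) ^ n.primeFactors.card := by
  unfold bvvOddFactor
  calc ∏ p ∈ n.primeFactors.erase 2, (1 + (jacobiSym a p : ℝ)) / (1 + (p : ℝ)⁻¹)
      ≤ ∏ _p ∈ n.primeFactors.erase 2, (2 : ℝ) := by
        refine Finset.prod_le_prod (fun p _ => ?_) (fun p _ => ?_)
        · refine div_nonneg ?_ (by positivity)
          rcases jacobiSym.trichotomy a p with h | h | h <;> simp [h]
        · refine (div_le_self ?_ (le_add_of_nonneg_right (by positivity))).trans ?_
          · rcases jacobiSym.trichotomy a p with h | h | h <;> simp [h]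
          · rcases jacobiSym.trichotomy a p with h | h | h <;> norm_num [h]
    _ = (2 : ℝ) ^ (n.primeFactors.erase 2).card := Finset.prod_const 2
    _ ≤ (2 : ℝ) ^ n.primeFactors.card :=
        pow_le_pow_right₀ (by norm_num) (Finset.card_erase_le)

/-- `2^{ω(n)} ≤ 4 n^{11/25}` for `n ≥ 1`: at most two prime factors of `n` are `< 5`, the number `k`
of prime factors `≥ 5` satisfies `5^k ≤ n`, and `2^25 ≤ 5^11`. (Any exponent `< 1/2` would do for
the summability below; this one avoids divisor-function bounds.) [folklore] -/
theorem two_pow_card_primeFactors_le_four_mul_rpow {n : ℕ} (hn : n ≠ 0) :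
    (2 : ℝ) ^ n.primeFactors.card ≤ 4 * (n : ℝ) ^ (11 / 25 : ℝ) := by
  set T := n.primeFactors.filter (5 ≤ ·)
  have hsub : n.primeFactors ⊆ insert 2 (insert 3 T) := by
    intro p hp
    have hp' := Nat.prime_of_mem_primeFactors hp
    by_cases h5 : 5 ≤ p
    · exact Finset.mem_insert_of_mem (Finset.mem_insert_of_mem (Finset.mem_filter.2 ⟨hp, h5⟩))
    · have h2 := hp'.two_le
      have h5' : p < 5 := Nat.lt_of_not_le h5
      interval_cases p
      · simp
      · simp
      · exact absurd hp' (by norm_num)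
  have hcard : n.primeFactors.card ≤ T.card + 2 :=
    calc n.primeFactors.card ≤ (insert 2 (insert 3 T)).card := Finset.card_le_card hsub
      _ ≤ (insert 3 T).card + 1 := Finset.card_insert_le _ _
      _ ≤ T.card + 1 + 1 := by gcongr; exact Finset.card_insert_le _ _
      _ = T.card + 2 := by ring
  have hprod : 5 ^ T.card ≤ n :=
    calc 5 ^ T.card ≤ ∏ p ∈ T, p :=
          Finset.pow_card_le_prod T (fun p => p) 5 (fun p hp => (Finset.mem_filter.1 hp).2)
      _ ≤ n := Nat.le_of_dvd (Nat.pos_of_ne_zero hn)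
          ((Finset.prod_dvd_prod_of_subset _ _ _ (Finset.filter_subset _ _)).trans
            (Nat.prod_primeFactors_dvd n))
  have key : ((n : ℝ) ^ (11 / 25 : ℝ)) ^ (25 : ℕ) = (n : ℝ) ^ (11 : ℕ) := by
    rw [← Real.rpow_natCast _ 25, ← Real.rpow_mul (Nat.cast_nonneg n), ← Real.rpow_natCast _ 11]
    norm_num
  have h25 : ((2 : ℝ) ^ T.card) ^ (25 : ℕ) ≤ ((n : ℝ) ^ (11 / 25 : ℝ)) ^ (25 : ℕ) := by
    rw [key]
    calc ((2 : ℝ) ^ T.card) ^ 25 = ((2 : ℝ) ^ 25) ^ T.card := pow_right_comm _ _ _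
      _ ≤ ((5 : ℝ) ^ 11) ^ T.card := by gcongr; norm_num
      _ = ((5 : ℝ) ^ T.card) ^ 11 := pow_right_comm _ _ _
      _ ≤ (n : ℝ) ^ 11 := by gcongr; exact_mod_cast hprod
  have hT' : (2 : ℝ) ^ T.card ≤ (n : ℝ) ^ (11 / 25 : ℝ) :=
    (pow_le_pow_iff_left₀ (by positivity) (by positivity) (by norm_num)).1 h25
  calc (2 : ℝ) ^ n.primeFactors.card ≤ (2 : ℝ) ^ (T.card + 2) :=
        pow_le_pow_right₀ (by norm_num) hcard
    _ = 4 * (2 : ℝ) ^ T.card := by ring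
    _ ≤ 4 * (n : ℝ) ^ (11 / 25 : ℝ) := by gcongr

/-- The majorant `2^{ω(n)} n^{-3/2}` is summable over `ℕ` (it is `≤ 4 n^{-53/50}`). [folklore] -/
theorem summable_two_pow_card_primeFactors_mul_rpow :
    Summable (fun n : ℕ => (2 : ℝ) ^ n.primeFactors.card * (n : ℝ) ^ (-(3 / 2 : ℝ))) := by
  have hs : Summable (fun n : ℕ => 4 * (n : ℝ) ^ (-(53 / 50 : ℝ))) :=
    (Real.summable_nat_rpow.2 (by norm_num)).mul_left 4
  refine Summable.of_nonneg_of_le (fun n => by positivity) (fun n => ?_) hs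
  rcases eq_or_ne n 0 with rfl | hn
  · simp [Real.zero_rpow (by norm_num : (-(3 / 2 : ℝ)) ≠ 0),
      Real.zero_rpow (by norm_num : (-(53 / 50 : ℝ)) ≠ 0)]
  · have hn' : (0 : ℝ) < n := by exact_mod_cast Nat.pos_of_ne_zero hn
    calc (2 : ℝ) ^ n.primeFactors.card * (n : ℝ) ^ (-(3 / 2 : ℝ))
        ≤ 4 * (n : ℝ) ^ (11 / 25 : ℝ) * (n : ℝ) ^ (-(3 / 2 : ℝ)) := by
          gcongr
          exact two_pow_card_primeFactors_le_four_mul_rpow hn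
      _ = 4 * (n : ℝ) ^ (-(53 / 50 : ℝ)) := by
          rw [mul_assoc, ← Real.rpow_add hn']
          norm_num

/-- Termwise majorant for (2.4): `μ²(y₀y₁y₂) (y₀y₁y₂)^{-3/2} σ_{2,y} ∏ ⋯ ≤ 2 ∏ᵢ 2^{ω(yᵢ)} yᵢ^{-3/2}`
(`σ_{2,y} ≤ 2` and each Euler factor `≤ 2^{ω(yᵢ)}`). [folklore] -/
theorem bvvSummand_le (y : ℕ × ℕ × ℕ) :
    bvvSummand y ≤ 2 * (((2 : ℝ) ^ y.1.primeFactors.card * (y.1 : ℝ) ^ (-(3 / 2 : ℝ))) *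
      (((2 : ℝ) ^ y.2.1.primeFactors.card * (y.2.1 : ℝ) ^ (-(3 / 2 : ℝ))) *
        ((2 : ℝ) ^ y.2.2.primeFactors.card * (y.2.2 : ℝ) ^ (-(3 / 2 : ℝ))))) := by
  obtain ⟨y₀, y₁, y₂⟩ := y
  unfold bvvSummand
  dsimp only
  split_ifs
  · have e : ((y₀ * y₁ * y₂ : ℕ) : ℝ) ^ (-(3 / 2 : ℝ)) =
        (y₀ : ℝ) ^ (-(3 / 2 : ℝ)) * (y₁ : ℝ) ^ (-(3 / 2 : ℝ)) * (y₂ : ℝ) ^ (-(3 / 2 : ℝ)) := by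
      rw [Nat.cast_mul, Nat.cast_mul, Real.mul_rpow (by positivity) (by positivity),
        Real.mul_rpow (by positivity) (by positivity)]
    rw [e]
    have h0 := bvvOddFactor_le_two_pow ((y₁ : ℤ) * y₂) y₀
    have h1 := bvvOddFactor_le_two_pow ((y₀ : ℤ) * y₂) y₁
    have h2 := bvvOddFactor_le_two_pow (-((y₀ : ℤ) * y₁)) y₂
    have hσ : (bvvSigmaTwo y₀ y₁ y₂ : ℝ) ≤ 2 := by exact_mod_cast bvvSigmaTwo_le_two y₀ y₁ y₂
    have g0 := bvvOddFactor_nonneg ((y₁ : ℤ) * y₂) y₀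
    have g1 := bvvOddFactor_nonneg ((y₀ : ℤ) * y₂) y₁
    have g2 := bvvOddFactor_nonneg (-((y₀ : ℤ) * y₁)) y₂
    have g01 := mul_nonneg g0 g1
    have g012 := mul_nonneg g01 g2
    calc (y₀ : ℝ) ^ (-(3 / 2 : ℝ)) * (y₁ : ℝ) ^ (-(3 / 2 : ℝ)) * (y₂ : ℝ) ^ (-(3 / 2 : ℝ)) *
          (bvvSigmaTwo y₀ y₁ y₂ : ℝ) *
          (bvvOddFactor ((y₁ : ℤ) * y₂) y₀ * bvvOddFactor ((y₀ : ℤ) * y₂) y₁ *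
            bvvOddFactor (-((y₀ : ℤ) * y₁)) y₂)
        ≤ (y₀ : ℝ) ^ (-(3 / 2 : ℝ)) * (y₁ : ℝ) ^ (-(3 / 2 : ℝ)) * (y₂ : ℝ) ^ (-(3 / 2 : ℝ)) * 2 *
          ((2 : ℝ) ^ y₀.primeFactors.card * (2 : ℝ) ^ y₁.primeFactors.card *
            (2 : ℝ) ^ y₂.primeFactors.card) := by
          gcongr
      _ = _ := by ring
  · positivity

/-- The series (2.4) defining `c` converges (absolutely: its terms are nonnegative), by comparison
with `2 (Σₙ 2^{ω(n)} n^{-3/2})³`. In particular `squarefulSumConstant` is the genuine value of (2.4)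
and not a junk `tsum`. [folklore] -/
theorem bvvSummand_summable : Summable bvvSummand := by
  have hg0 : ∀ n : ℕ, 0 ≤ (2 : ℝ) ^ n.primeFactors.card * (n : ℝ) ^ (-(3 / 2 : ℝ)) :=
    fun n => by positivity
  have hgs := summable_two_pow_card_primeFactors_mul_rpow
  have h2 := hgs.mul_of_nonneg hgs hg0 hg0
  have h3 := hgs.mul_of_nonneg h2 hg0 (fun y => mul_nonneg (hg0 _) (hg0 _))
  exact (h3.mul_left 2).of_nonneg_of_le bvvSummand_nonneg fun y => bvvSummand_le y

/-- `1/π ≤ c`: all terms of (2.4) are nonnegative and the term at `y = (1, 1, 1)` is `1`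
(cf. §1 of the paper: primitive Pythagorean triples alone give `N₁(B) ≳ √B/π`). [folklore] -/
theorem inv_pi_le_squarefulSumConstant : Real.pi⁻¹ ≤ squarefulSumConstant := by
  unfold squarefulSumConstant
  have h : bvvSummand (1, 1, 1) ≤ ∑' y, bvvSummand y :=
    bvvSummand_summable.le_tsum (1, 1, 1) (fun y _ => bvvSummand_nonneg y)
  rw [bvvSummand_one] at h
  calc Real.pi⁻¹ = Real.pi⁻¹ * 1 := (mul_one _).symm
    _ ≤ Real.pi⁻¹ * ∑' y, bvvSummand y := by gcongr

/-- The conjectural leading constant is positive: `0 < c` (indeed `c ≥ 1/π`; numerically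
`c = 2.677539267…`). [folklore] -/
theorem squarefulSumConstant_pos : 0 < squarefulSumConstant :=
  lt_of_lt_of_le (by positivity) inv_pi_le_squarefulSumConstant

/-- Since `c > 0`, Conjecture 1 (`SquarefulSumConjecture`, `N₁(B) ~ c √B`) is equivalently the
statement `N₁(B) / (c B^{1/2}) → 1` whose numerical evidence is plotted in Figure 1 and Table 1 of
the paper. [cite: BrowningValckenborgh2012, Conj. 1] -/
theorem squarefulSumConjecture_iff_tendsto :
    SquarefulSumConjecture ↔
      Tendsto (fun B : ℕ => (squarefulSumCount B : ℝ) / (squarefulSumConstant * Real.sqrt B))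
        atTop (nhds 1) := by
  unfold SquarefulSumConjecture
  refine Asymptotics.isEquivalent_iff_tendsto_one ?_
  filter_upwards [eventually_gt_atTop 0] with B hB
  exact mul_ne_zero squarefulSumConstant_pos.ne' (Real.sqrt_ne_zero'.2 (by exact_mod_cast hB))

end Literature.NumberTheory.DiophantineGeometry
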